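import Mathlib
import Summits.AtomisticToContinuum.HydrodynamicLimit.Theorems.ImplosionDichotomyDenseExcursionPackingAnalyticSourcesBound

/-!
# The sources of the hierarchy of `Γ` in the TWO-SCALE weights of `PackingResolventW`: the pointwise majorant bound
# with a weight `ω ≤ 1` on the `w`-source (crux `DenseExcursion`, stmt-AtomisticToContinuum-12586, line
# `sonic-cavity-renewal` v8, stub `stub_analyticPackingImplosion`)

Helper file (`--supports stmt-AtomisticToContinuum-12586`, line lead a2, wave-4 worker D1, task (0): the closure of the
majorant scheme under the WEAKER linear input `PackingResolventW`). Under `PackingResolventW` the `w`-component of the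
order-`k` solution does not gain `1/k` in the acoustic layer `R = eˣ ≍ s₀/(kμ)` at the centre, and the ONLY `k`-lossy
size of `X_k = (w_k, s_k)` is `(1 + S²)|(s_k/S)′| ≍ kμ|w_k|/3` there (the `Λ`-free inner model: `S²v′ = (Λu₁ − f₁)/3`
at leading order; worker numerics `work/stubs/numD1/sizes.py`: `D/(Λ·sup|u₁|/3) = 1.01–1.12` for inner-scale
`s`-sources, `Λ = 10 … 80`, while `sup|w_k′|` and `sup (1+S)|(s_k/S)′|` stay `Λ`-independent). The closure therefore
measures the `w`-source in the two weights `1/(1 + S)` (the weight of `PackingResolventW`) and `1/k` (the gain of the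
`w`-response to `w`-sources), in both of which the lossy factor is compensated. Kernel-checked here, ONE lemma serving all
three weights `ω ∈ {1, 1/(1+S), 1/k}`:

* `packingSources_bound_weighted` (REGISTERED helper): at a point `x`, for a weight `0 ≤ ω ≤ 1` and majorant numbers
  `T_i ≥ |wc i| + |wc i′| + |sc i|/S + (1 + ω S²)|(sc i/S)′|` (`1 ≤ i < k`),
  `ω|Src_w| + |Src_s|/S ≤ (9 + 3σ₂ + σ₁)[Gᵏ]T² + 3(1+σ₂) Σ_{p<k} [Gᵖ](1+T)² Σ_{j≤k−p} |m_j| Φʲ [G^{k−p−j}](1+T)^{3j}`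
  — the SAME right-hand side as `packingSources_bound` (which is the case `ω = 1`), so `majorant_shift` applies verbatim.
  Mechanism: every monomial of `Src_w` carries at most ONE factor `(sc j/S)′`, always multiplied by `S²·(value)`.

Pure real algebra over Mathlib's `PowerSeries`, adapted from `packingSources_bound`. NOT here: norms, the linear step, `Γ`.
-/

noncomputable section

open Finset PowerSeries

namespace Summit.AtomisticToContinuum.HydrodynamicLimit.Theorems.PackingAnalyticImplosion

-- adapted from `packingSources_bound` (…PackingAnalyticSourcesBound), weight `ω` inserted on the `w`-source
set_option maxHeartbeats 800000 in -- one declaration: many small `nlinarith`/`gcongr` steps of one pointwise estimate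
/-- **THE SOURCES IN THE TWO-SCALE WEIGHTS, POINTWISE** (registered helper `packingSources_bound_weighted` of
`stub_analyticPackingImplosion`): at a point `x`, with `S = sc 0 > 0`, `σ₁ ≥ |S′/S|`, `σ₂ ≥ |S(S′+S)|`, `Φ ≥ e^{3x}S³`,
a weight `0 ≤ ω ≤ 1` and majorant numbers `T_i ≥ |wc i| + |wc i′| + |sc i|/S + (1 + ω S²)|(sc i/S)′|` for `1 ≤ i < k`
(`T₀ = 0`, `T ≥ 0`), the order-`k` sources of `packingHierarchy_order` satisfy
`ω|Src_w| + |Src_s|/S ≤ (9 + 3σ₂ + σ₁)[Gᵏ]T² + 3(1+σ₂) Σ_{p<k} [Gᵖ](1+T)² Σ_{j≤k−p} |m_j| Φʲ [G^{k−p−j}](1+T)^{3j}`.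
[folklore] -/
theorem packingSources_bound_weighted : ∀ (wc sc : ℕ → ℝ → ℝ) (m : ℕ → ℝ) (Mc : ℕ → ℝ → ℝ) (Sw Ss : ℝ → ℝ) (T : ℕ → ℝ) (k : ℕ) (x σ₁ σ₂ Φ ω : ℝ), (∀ c, Mc c x = ∑ j ∈ Finset.range (c + 1), m j * Real.exp (3 * x) ^ j * PowerSeries.coeff (c - j) ((PowerSeries.mk fun n => sc n x) ^ (3 * j))) → (Sw x = (∑ i ∈ Finset.Ico 1 k, (wc i x * deriv (wc (k - i)) x + wc i x * wc (k - i) x + 3 * (sc i x * (deriv (sc (k - i)) x + sc (k - i) x)))) + 3 * ∑ p ∈ Finset.range k, (∑ i ∈ Finset.range (p + 1), sc i x * (deriv (sc (p - i)) x + sc (p - i) x)) * Mc (k - p) x) → (Ss x = ∑ i ∈ Finset.Ico 1 k, (wc i x * deriv (sc (k - i)) x + sc i x / 3 * deriv (wc (k - i)) x + 2 * (sc i x * wc (k - i) x))) → 0 < sc 0 x → (∀ i, i < k → DifferentiableAt ℝ (sc i) x) → |deriv (sc 0) x / sc 0 x| ≤ σ₁ → |sc 0 x * (deriv (sc 0)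 x + sc 0 x)| ≤ σ₂ → Real.exp (3 * x) * sc 0 x ^ 3 ≤ Φ → 0 ≤ ω → ω ≤ 1 → T 0 = 0 → (∀ i, 0 ≤ T i) → (∀ i, 1 ≤ i → i < k → |wc i x| + |deriv (wc i) x| + |sc i x| / sc 0 x + (1 + ω * sc 0 x ^ 2) * |deriv (fun y => sc i y / sc 0 y) x| ≤ T i) → ω * |Sw x| + |Ss x| / sc 0 x ≤ (9 + 3 * σ₂ + σ₁) * PowerSeries.coeff k (PowerSeries.mk T ^ 2) + 3 * (1 + σ₂) * ∑ p ∈ Finset.range k, PowerSeries.coeff p ((1 + PowerSeries.mk T) ^ 2) * ∑ j ∈ Finset.range (k - p + 1), |m j| * Φ ^ j * PowerSeries.coeff (k - p - j) ((1 + PowerSeries.mk T) ^ (3 * j)) := by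
  intro wc sc m Mc Sw Ss T k x σ₁ σ₂ Φ ω hMc hSw hSs hS hdiff hσ₁ hσ₂ hΦ hω0 hω1 hT0 hTnn hT
  -- the trivial case `k = 0`
  rcases Nat.eq_zero_or_pos k with rfl | hk
  · simp only [Finset.range_zero, Finset.sum_empty, mul_zero, add_zero,
      Finset.Ico_eq_empty (by norm_num : ¬ (1:ℕ) < 0)] at hSw hSs
    rw [hSw, hSs]
    simp only [abs_zero, zero_div, mul_zero, add_zero, Finset.range_zero, Finset.sum_empty]
    have : 0 ≤ PowerSeries.coeff 0 (PowerSeries.mk T ^ 2) := by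
      rw [coeff_zero_mk_pow, hT0]; norm_num
    have hσ₁' : 0 ≤ σ₁ := (abs_nonneg _).trans hσ₁
    have hσ₂' : 0 ≤ σ₂ := (abs_nonneg _).trans hσ₂
    positivity
  -- notation at the point `x`
  set S : ℝ := sc 0 x with hSdef
  set S' : ℝ := deriv (sc 0) x with hS'def
  have hS0 : S ≠ 0 := hS.ne'
  have hσ₁' : 0 ≤ σ₁ := (abs_nonneg _).trans hσ₁
  have hσ₂' : 0 ≤ σ₂ := (abs_nonneg _).trans hσ₂
  have hΦ0 : 0 ≤ Real.exp (3 * x) * S ^ 3 := by positivity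
  have hΦ' : 0 ≤ Φ := hΦ0.trans hΦ
  set v : ℕ → ℝ := fun i => sc i x / S with hvdef
  set v' : ℕ → ℝ := fun i => deriv (fun y => sc i y / sc 0 y) x with hv'def
  set U : ℕ → ℝ := fun n => if n = 0 then 1 else T n with hUdef
  have hU0 : U 0 = 1 := by simp [hUdef]
  have hUpos : ∀ n, 1 ≤ n → U n = T n := fun n hn => by simp [hUdef, show n ≠ 0 by omega]
  have hUnn : ∀ n, 0 ≤ U n := fun n => by
    rcases Nat.eq_zero_or_pos n with rfl | hn
    · rw [hU0]; norm_num
    · rw [hUpos n hn]; exact hTnn n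
  have eU : (1 + PowerSeries.mk T : PowerSeries ℝ) = PowerSeries.mk U := one_add_mk_eq hT0
  -- values and derivatives of the `s`-coefficients through `v`, `v'`
  have hv0 : v 0 = 1 := by
    show sc 0 x / S = 1
    rw [← hSdef]; exact div_self hS0
  have hsc : ∀ i, sc i x = S * v i := fun i => by simp only [hvdef]; field_simp
  have hdsc : ∀ i, i < k → deriv (sc i) x = S * v' i + S' * v i := by
    intro i hi
    have hd : deriv (fun y => sc i y / sc 0 y) x =
        (deriv (sc i) x * sc 0 x - sc i x * deriv (sc 0) x) / sc 0 x ^ 2 :=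
      ((hdiff i hi).hasDerivAt.div (hdiff 0 hk).hasDerivAt hS0).deriv
    rw [← hSdef, ← hS'def] at hd
    simp only [hv'def, hvdef]
    rw [hd]
    field_simp
    ring
  -- the bounds on the lower orders
  have hωS : 0 ≤ ω * sc 0 x ^ 2 := mul_nonneg hω0 (sq_nonneg _)
  have hbw : ∀ i, 1 ≤ i → i < k → |wc i x| ≤ T i := fun i h1 h2 => by
    have := hT i h1 h2
    have h3 : 0 ≤ |sc i x| / sc 0 x := by positivity
    nlinarith [abs_nonneg (deriv (wc i) x), abs_nonneg (deriv (fun y => sc i y / sc 0 y) x), hωS]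
  have hbw' : ∀ i, 1 ≤ i → i < k → |deriv (wc i) x| ≤ T i := fun i h1 h2 => by
    have := hT i h1 h2
    have h3 : 0 ≤ |sc i x| / sc 0 x := by positivity
    nlinarith [abs_nonneg (wc i x), abs_nonneg (deriv (fun y => sc i y / sc 0 y) x), hωS]
  have hbv : ∀ i, 1 ≤ i → i < k → |v i| ≤ T i := fun i h1 h2 => by
    have := hT i h1 h2
    have e : |v i| = |sc i x| / sc 0 x := by rw [hvdef]; simp only; rw [abs_div, abs_of_pos hS]
    rw [e]
    nlinarith [abs_nonneg (wc i x), abs_nonneg (deriv (wc i) x), abs_nonneg (deriv (fun y => sc i y / sc 0 y) x),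
      hωS]
  have hbv' : ∀ i, 1 ≤ i → i < k → |v' i| ≤ T i ∧ ω * |S ^ 2 * v' i| ≤ T i := fun i h1 h2 => by
    have := hT i h1 h2
    have h3 : 0 ≤ |sc i x| / sc 0 x := by positivity
    have h4 : |S ^ 2 * v' i| = S ^ 2 * |v' i| := by rw [abs_mul, abs_of_nonneg (sq_nonneg S)]
    simp only [hv'def] at h4 ⊢
    rw [h4]
    constructor <;> nlinarith [abs_nonneg (wc i x), abs_nonneg (deriv (wc i) x),
      abs_nonneg (deriv (fun y => sc i y / sc 0 y) x), hωS, hω0]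
  have hvU : ∀ i, i < k → |v i| ≤ U i := fun i hi => by
    rcases Nat.eq_zero_or_pos i with rfl | h1
    · rw [hv0, hU0, abs_one]
    · rw [hUpos i h1]; exact hbv i h1 hi
  -- THE WEIGHTED PRESSURE MONOMIALS: `ω |sc i (sc j′ + sc j)| ≤ (1 + σ₂) U_i U_j`
  have hP : ∀ i j, i < k → j < k → ω * |sc i x * (deriv (sc j) x + sc j x)| ≤ (1 + σ₂) * U i * U j := by
    intro i j hi hj
    have hσ₂S : |S * (S' + S)| ≤ σ₂ := hσ₂
    rcases Nat.eq_zero_or_pos j with rfl | hj1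
    · -- `j = 0`: the factor is `S(S′ + S)`
      have e : sc i x * (deriv (sc 0) x + sc 0 x) = v i * (S * (S' + S)) := by rw [hsc i]; ring
      rw [e, abs_mul, hU0, mul_one]
      calc ω * (|v i| * |S * (S' + S)|) ≤ 1 * (U i * σ₂) := by
            apply mul_le_mul hω1 _ (by positivity) zero_le_one
            exact mul_le_mul (hvU i hi) hσ₂S (abs_nonneg _) (hUnn i)
        _ ≤ (1 + σ₂) * U i := by nlinarith [hUnn i]
    · -- `j ≥ 1`: `S² v_i v_j′ + S(S′+S) v_i v_j`
      have e : sc i x * (deriv (sc j) x + sc j x) = v i * (S ^ 2 * v' j) + v i * v j * (S * (S' + S)) := by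
        rw [hsc i, hdsc j hj, hsc j]; ring
      rw [e, hUpos j hj1]
      obtain ⟨-, h2⟩ := hbv' j hj1 hj
      have hsplit : ω * |v i * (S ^ 2 * v' j) + v i * v j * (S * (S' + S))| ≤
          |v i| * (ω * |S ^ 2 * v' j|) + ω * (|v i| * |v j| * |S * (S' + S)|) := by
        have h5 : |v i * (S ^ 2 * v' j) + v i * v j * (S * (S' + S))| ≤
            |v i| * |S ^ 2 * v' j| + |v i| * |v j| * |S * (S' + S)| := by
          calc _ ≤ |v i * (S ^ 2 * v' j)| + |v i * v j * (S * (S' + S))| := abs_add_le _ _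
            _ = _ := by rw [abs_mul (v i) (S ^ 2 * v' j), abs_mul (v i * v j), abs_mul (v i) (v j)]
        have h6 := mul_le_mul_of_nonneg_left h5 hω0
        linarith [h6]
      have h7 : |v i| * (ω * |S ^ 2 * v' j|) ≤ U i * T j :=
        mul_le_mul (hvU i hi) h2 (mul_nonneg hω0 (abs_nonneg _)) (hUnn i)
      have h8 : ω * (|v i| * |v j| * |S * (S' + S)|) ≤ 1 * (U i * T j * σ₂) := by
        apply mul_le_mul hω1 _ (by positivity) zero_le_one
        exact mul_le_mul (mul_le_mul (hvU i hi) (hbv j hj1 hj) (abs_nonneg _) (hUnn i)) hσ₂S (abs_nonneg _)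
          (mul_nonneg (hUnn i) (hTnn j))
      calc _ ≤ |v i| * (ω * |S ^ 2 * v' j|) + ω * (|v i| * |v j| * |S * (S' + S)|) := hsplit
        _ ≤ U i * T j + 1 * (U i * T j * σ₂) := add_le_add h7 h8
        _ = (1 + σ₂) * U i * T j := by ring
  -- the inner sums
  have hinner : ∀ p, p < k → ω * |∑ i ∈ range (p + 1), sc i x * (deriv (sc (p - i)) x + sc (p - i) x)| ≤
      (1 + σ₂) * coeff p ((PowerSeries.mk U) ^ 2) := by
    intro p hp
    have e : ω * |∑ i ∈ range (p + 1), sc i x * (deriv (sc (p - i)) x + sc (p - i) x)| =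
        |∑ i ∈ range (p + 1), ω * (sc i x * (deriv (sc (p - i)) x + sc (p - i) x))| := by
      rw [← mul_sum, abs_mul, abs_of_nonneg hω0]
    rw [e]
    refine inner_sum_le (F := fun i j => ω * (sc i x * (deriv (sc j) x + sc j x))) fun i hi => ?_
    have h := hP i (p - i) (by omega) (by omega)
    have e2 : |ω * (sc i x * (deriv (sc (p - i)) x + sc (p - i) x))| =
        ω * |sc i x * (deriv (sc (p - i)) x + sc (p - i) x)| := by
      rw [abs_mul, abs_of_nonneg hω0]
    rw [e2]
    exact h
  -- the stiffening coefficients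
  have hMcb : ∀ c, 1 ≤ c → c ≤ k → |Mc c x| ≤ ∑ j ∈ range (c + 1), |m j| * Φ ^ j *
      coeff (c - j) ((PowerSeries.mk U) ^ (3 * j)) := by
    intro c hc1 hck
    rw [hMc c]
    refine (abs_sum_le_sum_abs _ _).trans (sum_le_sum fun j hj => ?_)
    have hjc : j ≤ c := Nat.lt_succ_iff.mp (mem_range.mp hj)
    have emk : (PowerSeries.mk fun n => sc n x) = PowerSeries.mk fun n => S * v n := by
      ext n; simp [coeff_mk, hsc n]
    have e1 : |m j * Real.exp (3 * x) ^ j * coeff (c - j) ((PowerSeries.mk fun n => sc n x) ^ (3 * j))| =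
        |m j| * (Real.exp (3 * x) * S ^ 3) ^ j * |coeff (c - j) ((PowerSeries.mk v) ^ (3 * j))| := by
      rw [emk, coeff_mk_const_mul_pow, abs_mul, abs_mul, abs_mul, abs_of_nonneg (pow_nonneg (Real.exp_pos _).le j),
        abs_of_nonneg (pow_nonneg hS.le _), pow_mul, mul_pow]
      ring
    rw [e1]
    have h1 : (Real.exp (3 * x) * S ^ 3) ^ j ≤ Φ ^ j := pow_le_pow_left₀ hΦ0 hΦ j
    have h2 : |coeff (c - j) ((PowerSeries.mk v) ^ (3 * j))| ≤ coeff (c - j) ((PowerSeries.mk U) ^ (3 * j)) := by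
      rcases Nat.eq_zero_or_pos j with rfl | hj1
      · simp only [mul_zero, pow_zero, coeff_one]
        split_ifs <;> simp
      · refine (abs_coeff_mk_pow_le v (3 * j) (c - j)).trans ?_
        have hmono := coeff_pow_mono (t := fun n => |v n|) (c := U) (j := c - j)
          (fun n hn => ⟨abs_nonneg _, hvU n (by omega)⟩) (3 * j) (c - j) le_rfl
        exact hmono.2
    have h3 : 0 ≤ coeff (c - j) ((PowerSeries.mk U) ^ (3 * j)) :=
      (coeff_pow_mono (t := U) (c := U) (j := c - j) (fun n _ => ⟨hUnn n, le_rfl⟩) (3 * j) (c - j) le_rfl).1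
    have h4 : 0 ≤ |m j| := abs_nonneg _
    exact mul_le_mul (mul_le_mul_of_nonneg_left h1 h4) h2 (abs_nonneg _) (mul_nonneg h4 (pow_nonneg hΦ' _))
  -- the quadratic sums are dominated by `[Gᵏ] T²`
  have hquad : ∑ i ∈ Ico 1 k, T i * T (k - i) ≤ coeff k ((PowerSeries.mk T) ^ 2) := by
    rw [coeff_mk_sq]
    refine sum_le_sum_of_subset_of_nonneg (fun i hi => ?_) fun i _ _ => mul_nonneg (hTnn _) (hTnn _)
    rw [mem_Ico] at hi; rw [mem_range]; omega
  have hquad0 : 0 ≤ coeff k ((PowerSeries.mk T) ^ 2) :=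
    (sum_nonneg fun i _ => mul_nonneg (hTnn i) (hTnn (k - i))).trans hquad
  -- the weighted `w`-source
  have hW : ω * |Sw x| ≤ (5 + 3 * σ₂) * coeff k ((PowerSeries.mk T) ^ 2) + 3 * (1 + σ₂) * ∑ p ∈ range k,
      coeff p ((PowerSeries.mk U) ^ 2) * ∑ j ∈ range (k - p + 1), |m j| * Φ ^ j *
        coeff (k - p - j) ((PowerSeries.mk U) ^ (3 * j)) := by
    rw [hSw]
    have hsplit : ω * |(∑ i ∈ Ico 1 k, (wc i x * deriv (wc (k - i)) x + wc i x * wc (k - i) x +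
          3 * (sc i x * (deriv (sc (k - i)) x + sc (k - i) x)))) +
          3 * ∑ p ∈ range k, (∑ i ∈ range (p + 1), sc i x * (deriv (sc (p - i)) x + sc (p - i) x)) * Mc (k - p) x|
        ≤ ω * |∑ i ∈ Ico 1 k, (wc i x * deriv (wc (k - i)) x + wc i x * wc (k - i) x +
          3 * (sc i x * (deriv (sc (k - i)) x + sc (k - i) x)))| +
          ω * |3 * ∑ p ∈ range k, (∑ i ∈ range (p + 1), sc i x * (deriv (sc (p - i)) x + sc (p - i) x)) *
            Mc (k - p) x| := by
      rw [← mul_add]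
      exact mul_le_mul_of_nonneg_left (abs_add_le _ _) hω0
    refine hsplit.trans (add_le_add ?_ ?_)
    · -- the quadratic part
      have e : ω * |∑ i ∈ Ico 1 k, (wc i x * deriv (wc (k - i)) x + wc i x * wc (k - i) x +
            3 * (sc i x * (deriv (sc (k - i)) x + sc (k - i) x)))| =
          |∑ i ∈ Ico 1 k, ω * (wc i x * deriv (wc (k - i)) x + wc i x * wc (k - i) x +
            3 * (sc i x * (deriv (sc (k - i)) x + sc (k - i) x)))| := by
        rw [← mul_sum, abs_mul, abs_of_nonneg hω0]
      rw [e]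
      refine (abs_sum_le_sum_abs _ _).trans ?_
      calc ∑ i ∈ Ico 1 k, |ω * (wc i x * deriv (wc (k - i)) x + wc i x * wc (k - i) x +
              3 * (sc i x * (deriv (sc (k - i)) x + sc (k - i) x)))|
          ≤ ∑ i ∈ Ico 1 k, (5 + 3 * σ₂) * (T i * T (k - i)) := by
            refine sum_le_sum fun i hi => ?_
            obtain ⟨hi1, hik⟩ := mem_Ico.mp hi
            have hki1 : 1 ≤ k - i := by omega
            have hkik : k - i < k := by omega
            have hTT : 0 ≤ T i * T (k - i) := mul_nonneg (hTnn _) (hTnn _)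
            have h1 : |wc i x * deriv (wc (k - i)) x| ≤ T i * T (k - i) := by
              rw [abs_mul]; exact mul_le_mul (hbw i hi1 hik) (hbw' _ hki1 hkik) (abs_nonneg _) (hTnn _)
            have h2 : |wc i x * wc (k - i) x| ≤ T i * T (k - i) := by
              rw [abs_mul]; exact mul_le_mul (hbw i hi1 hik) (hbw _ hki1 hkik) (abs_nonneg _) (hTnn _)
            have h3 : ω * |3 * (sc i x * (deriv (sc (k - i)) x + sc (k - i) x))| ≤
                3 * ((1 + σ₂) * T i * T (k - i)) := by
              rw [abs_mul, abs_of_pos (by norm_num : (0:ℝ) < 3)]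
              have := hP i (k - i) hik hkik
              rw [hUpos i hi1, hUpos (k - i) hki1] at this
              nlinarith [this]
            have h12 : ω * (|wc i x * deriv (wc (k - i)) x| + |wc i x * wc (k - i) x|) ≤
                1 * (T i * T (k - i) + T i * T (k - i)) :=
              mul_le_mul hω1 (add_le_add h1 h2) (by positivity) zero_le_one
            rw [abs_mul, abs_of_nonneg hω0]
            calc ω * |wc i x * deriv (wc (k - i)) x + wc i x * wc (k - i) x +
                  3 * (sc i x * (deriv (sc (k - i)) x + sc (k - i) x))|
                ≤ ω * (|wc i x * deriv (wc (k - i)) x + wc i x * wc (k - i) x| +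
                  |3 * (sc i x * (deriv (sc (k - i)) x + sc (k - i) x))|) :=
                  mul_le_mul_of_nonneg_left (abs_add_le _ _) hω0
              _ ≤ ω * ((|wc i x * deriv (wc (k - i)) x| + |wc i x * wc (k - i) x|) +
                  |3 * (sc i x * (deriv (sc (k - i)) x + sc (k - i) x))|) := by
                  gcongr; exact abs_add_le _ _
              _ = ω * (|wc i x * deriv (wc (k - i)) x| + |wc i x * wc (k - i) x|) +
                  ω * |3 * (sc i x * (deriv (sc (k - i)) x + sc (k - i) x))| := by ring
              _ ≤ 1 * (T i * T (k - i) + T i * T (k - i)) + 3 * ((1 + σ₂) * T i * T (k - i)) :=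
                  add_le_add h12 h3
              _ = (5 + 3 * σ₂) * (T i * T (k - i)) := by ring
        _ = (5 + 3 * σ₂) * ∑ i ∈ Ico 1 k, T i * T (k - i) := by rw [mul_sum]
        _ ≤ (5 + 3 * σ₂) * coeff k ((PowerSeries.mk T) ^ 2) := mul_le_mul_of_nonneg_left hquad (by linarith)
    · -- the stiffening part: `|Σ| ≤ Σ|·|` first, then termwise
      have hle1 : ω * |3 * ∑ p ∈ range k, (∑ i ∈ range (p + 1), sc i x * (deriv (sc (p - i)) x + sc (p - i) x)) *
            Mc (k - p) x| ≤ 3 * ∑ p ∈ range k, ω * |(∑ i ∈ range (p + 1), sc i x *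
              (deriv (sc (p - i)) x + sc (p - i) x)) * Mc (k - p) x| := by
        rw [abs_mul, abs_of_pos (by norm_num : (0:ℝ) < 3)]
        have habs := abs_sum_le_sum_abs (fun p => (∑ i ∈ range (p + 1), sc i x *
          (deriv (sc (p - i)) x + sc (p - i) x)) * Mc (k - p) x) (range k)
        have h' := mul_le_mul_of_nonneg_left habs (mul_nonneg hω0 (by norm_num : (0:ℝ) ≤ 3))
        calc ω * (3 * |∑ p ∈ range k, (∑ i ∈ range (p + 1), sc i x * (deriv (sc (p - i)) x + sc (p - i) x)) *
              Mc (k - p) x|) = ω * 3 * |∑ p ∈ range k, (∑ i ∈ range (p + 1), sc i x *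
                (deriv (sc (p - i)) x + sc (p - i) x)) * Mc (k - p) x| := by ring
          _ ≤ ω * 3 * ∑ p ∈ range k, |(∑ i ∈ range (p + 1), sc i x * (deriv (sc (p - i)) x + sc (p - i) x)) *
              Mc (k - p) x| := h'
          _ = 3 * ∑ p ∈ range k, ω * |(∑ i ∈ range (p + 1), sc i x *
              (deriv (sc (p - i)) x + sc (p - i) x)) * Mc (k - p) x| := by
              rw [mul_sum, mul_sum]
              refine sum_congr rfl fun p _ => ?_
              ring
      refine hle1.trans ?_
      have hterm : ∀ p ∈ range k, ω * |(∑ i ∈ range (p + 1), sc i x * (deriv (sc (p - i)) x + sc (p - i) x)) *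
          Mc (k - p) x| ≤ (1 + σ₂) * (coeff p ((PowerSeries.mk U) ^ 2) *
            ∑ j ∈ range (k - p + 1), |m j| * Φ ^ j * coeff (k - p - j) ((PowerSeries.mk U) ^ (3 * j))) := by
        intro p hp
        have hp' : p < k := mem_range.mp hp
        rw [abs_mul, ← mul_assoc]
        have h1 := hinner p hp'
        have h2 := hMcb (k - p) (by omega) (by omega)
        calc ω * |∑ i ∈ range (p + 1), sc i x * (deriv (sc (p - i)) x + sc (p - i) x)| * |Mc (k - p) x|
            ≤ ((1 + σ₂) * coeff p ((PowerSeries.mk U) ^ 2)) *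
                ∑ j ∈ range (k - p + 1), |m j| * Φ ^ j * coeff (k - p - j) ((PowerSeries.mk U) ^ (3 * j)) :=
              mul_le_mul h1 h2 (abs_nonneg _) (by
                have : 0 ≤ coeff p ((PowerSeries.mk U) ^ 2) :=
                  (coeff_pow_mono (t := U) (c := U) (j := p) (fun n _ => ⟨hUnn n, le_rfl⟩) 2 p le_rfl).1
                positivity)
          _ = (1 + σ₂) * (coeff p ((PowerSeries.mk U) ^ 2) *
                ∑ j ∈ range (k - p + 1), |m j| * Φ ^ j * coeff (k - p - j) ((PowerSeries.mk U) ^ (3 * j))) := by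
              ring
      calc 3 * ∑ p ∈ range k, ω * |(∑ i ∈ range (p + 1), sc i x * (deriv (sc (p - i)) x + sc (p - i) x)) *
            Mc (k - p) x| ≤ 3 * ∑ p ∈ range k, (1 + σ₂) * (coeff p ((PowerSeries.mk U) ^ 2) *
              ∑ j ∈ range (k - p + 1), |m j| * Φ ^ j * coeff (k - p - j) ((PowerSeries.mk U) ^ (3 * j))) :=
            mul_le_mul_of_nonneg_left (sum_le_sum hterm) (by norm_num)
        _ = 3 * (1 + σ₂) * ∑ p ∈ range k, coeff p ((PowerSeries.mk U) ^ 2) *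
              ∑ j ∈ range (k - p + 1), |m j| * Φ ^ j * coeff (k - p - j) ((PowerSeries.mk U) ^ (3 * j)) := by
            rw [mul_sum, mul_sum]
            refine sum_congr rfl fun p _ => ?_
            ring
  -- the `s`-source over `S`
  have hSb : |Ss x| / sc 0 x ≤ (4 + σ₁) * coeff k ((PowerSeries.mk T) ^ 2) := by
    rw [← hSdef, ← abs_of_pos hS, ← abs_div, hSs, sum_div]
    refine (abs_sum_le_sum_abs _ _).trans ?_
    calc ∑ i ∈ Ico 1 k, |(wc i x * deriv (sc (k - i)) x + sc i x / 3 * deriv (wc (k - i)) x +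
            2 * (sc i x * wc (k - i) x)) / S|
        ≤ ∑ i ∈ Ico 1 k, (4 + σ₁) * (T i * T (k - i)) := by
          refine sum_le_sum fun i hi => ?_
          obtain ⟨hi1, hik⟩ := mem_Ico.mp hi
          have hki1 : 1 ≤ k - i := by omega
          have hkik : k - i < k := by omega
          have e : (wc i x * deriv (sc (k - i)) x + sc i x / 3 * deriv (wc (k - i)) x + 2 * (sc i x * wc (k - i) x)) / S
              = wc i x * v' (k - i) + wc i x * (S' / S) * v (k - i) + 1 / 3 * (v i * deriv (wc (k - i)) x) +
                2 * (v i * wc (k - i) x) := by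
            rw [hdsc (k - i) hkik, hsc i]; field_simp
          rw [e]
          have hσ : |S' / S| ≤ σ₁ := hσ₁
          have h1 : |wc i x * v' (k - i)| ≤ T i * T (k - i) := by
            rw [abs_mul]; exact mul_le_mul (hbw i hi1 hik) (hbv' _ hki1 hkik).1 (abs_nonneg _) (hTnn _)
          have h2 : |wc i x * (S' / S) * v (k - i)| ≤ T i * σ₁ * T (k - i) := by
            rw [abs_mul, abs_mul]
            exact mul_le_mul (mul_le_mul (hbw i hi1 hik) hσ (abs_nonneg _) (hTnn _)) (hbv _ hki1 hkik)
              (abs_nonneg _) (mul_nonneg (hTnn _) hσ₁')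
          have h3 : |1 / 3 * (v i * deriv (wc (k - i)) x)| ≤ 1 / 3 * (T i * T (k - i)) := by
            rw [abs_mul, abs_of_pos (by norm_num : (0:ℝ) < 1 / 3), abs_mul]
            exact mul_le_mul_of_nonneg_left (mul_le_mul (hbv i hi1 hik) (hbw' _ hki1 hkik) (abs_nonneg _) (hTnn _))
              (by norm_num)
          have h4 : |2 * (v i * wc (k - i) x)| ≤ 2 * (T i * T (k - i)) := by
            rw [abs_mul, abs_of_pos (by norm_num : (0:ℝ) < 2), abs_mul]
            exact mul_le_mul_of_nonneg_left (mul_le_mul (hbv i hi1 hik) (hbw _ hki1 hkik) (abs_nonneg _) (hTnn _))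
              (by norm_num)
          have hTT : 0 ≤ T i * T (k - i) := mul_nonneg (hTnn _) (hTnn _)
          calc _ ≤ |wc i x * v' (k - i) + wc i x * (S' / S) * v (k - i) + 1 / 3 * (v i * deriv (wc (k - i)) x)| +
                |2 * (v i * wc (k - i) x)| := abs_add_le _ _
            _ ≤ (|wc i x * v' (k - i) + wc i x * (S' / S) * v (k - i)| + |1 / 3 * (v i * deriv (wc (k - i)) x)|) +
                |2 * (v i * wc (k - i) x)| := by gcongr; exact abs_add_le _ _
            _ ≤ ((|wc i x * v' (k - i)| + |wc i x * (S' / S) * v (k - i)|) + |1 / 3 * (v i * deriv (wc (k - i)) x)|) +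
                |2 * (v i * wc (k - i) x)| := by gcongr; exact abs_add_le _ _
            _ ≤ ((T i * T (k - i) + T i * σ₁ * T (k - i)) + 1 / 3 * (T i * T (k - i))) + 2 * (T i * T (k - i)) := by
                gcongr
            _ ≤ (4 + σ₁) * (T i * T (k - i)) := by nlinarith
      _ = (4 + σ₁) * ∑ i ∈ Ico 1 k, T i * T (k - i) := by rw [mul_sum]
      _ ≤ (4 + σ₁) * coeff k ((PowerSeries.mk T) ^ 2) := mul_le_mul_of_nonneg_left hquad (by linarith)
  -- assemble
  rw [eU]
  have hsum0 : 0 ≤ ∑ p ∈ range k, coeff p ((PowerSeries.mk U) ^ 2) * ∑ j ∈ range (k - p + 1), |m j| * Φ ^ j *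
      coeff (k - p - j) ((PowerSeries.mk U) ^ (3 * j)) :=
    sum_nonneg fun p _ => mul_nonneg
      (coeff_pow_mono (t := U) (c := U) (j := p) (fun n _ => ⟨hUnn n, le_rfl⟩) 2 p le_rfl).1
      (sum_nonneg fun j _ => mul_nonneg (mul_nonneg (abs_nonneg _) (pow_nonneg hΦ' _))
        (coeff_pow_mono (t := U) (c := U) (j := k - p - j) (fun n _ => ⟨hUnn n, le_rfl⟩) (3 * j) _ le_rfl).1)
  linarith [hW, hSb]

end Summit.AtomisticToContinuum.HydrodynamicLimit.Theorems.PackingAnalyticImplosion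

end
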